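import Mathlib
import Literature.NumberTheory.Transcendental.KZLogCalculusProofs
import Summits.KontsevichZagierPeriods.KontsevichZagierPeriods.Theses.InverseLandau

/-!
# `TateLifting`, line `Sketch`, stub `stub_zsmulRep` — integer multiples of a representation

Crux stmt-KontsevichZagierPeriods-9129 (`Summit.KontsevichZagierPeriods.KontsevichZagierPeriods.Theses.InverseLandau.TateLifting`),
weight-one sector bookkeeping. If `r'` has the domain of `r` and integrand `m · (integrand of r)` on
it (`m ∈ ℤ`), then `[r'] − m • [r]` is a relation of the KZ calculus (iterated integrand additivity
`KZ.integrandAddRel`, plus the zero representation and negation; cf.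
`KZ.of_sub_of_mem_relations_of_eqOn`, `KZ.of_add_of_mem_relations_of_eqOn_neg`,
`KZ.of_sub_of_sub_sum_mem_relations` in `KZLogCalculusProofs.lean`).
-/

noncomputable section

namespace Summit.KontsevichZagierPeriods.InverseLandau

open Literature.NumberTheory.Transcendental

/-- **Integer multiples** (stub `stub_zsmulRep` of line `Sketch` for crux `TateLifting`): a
representation whose integrand is `m` times that of `r` on the common domain differs from `m • [r]`
by a relation. [cite: KontsevichZagier2001, §1.2] -/
theorem tateLifting_zsmulRep :
    ∀ (n : ℕ) (m : ℤ) (r r' : KZ.IntegralRep n), r'.domain = r.domain →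
      Set.EqOn r'.integrand (fun x => (m : ℝ) * r.integrand x) r.domain →
      KZ.of r' - m • KZ.of r ∈ KZ.relations := by
  intro n m r r' hd h
  -- the zero representation `z = [r.domain, 0]`, itself a relation
  obtain ⟨z, hzd, hzi⟩ := KZ.exists_zeroRep r.isSemialgebraic_domain
  have hz : KZ.of z ∈ KZ.relations :=
    KZ.of_mem_relations_of_eqOn_zero z fun x _ => by simp [hzi]
  obtain ⟨k, rfl | rfl⟩ := m.eq_nat_or_neg
  · -- `m = k ≥ 0`: `[r'] − [z] − Σ_{i<k} [r]` is iterated integrand additivity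
    have h1 : KZ.of r' - KZ.of z - ∑ _i : Fin k, KZ.of r ∈ KZ.relations :=
      KZ.of_sub_of_sub_sum_mem_relations k r' z (fun _ => r) (hzd.trans hd.symm)
        (fun _ => hd.symm) fun x hx => by
          have hx' : x ∈ r.domain := hd ▸ hx
          simp only [h hx', hzi, Pi.zero_apply, zero_add, Finset.sum_const, Finset.card_univ,
            Fintype.card_fin, nsmul_eq_mul, Int.cast_natCast]
    rw [Finset.sum_const, Finset.card_univ, Fintype.card_fin] at h1
    have : KZ.of r' - (k : ℤ) • KZ.of r = (KZ.of r' - KZ.of z - k • KZ.of r) + KZ.of z := by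
      rw [natCast_zsmul]; abel
    rw [this]
    exact KZ.relations.add_mem h1 hz
  · -- `m = -k ≤ 0`: `[z] − [r'] − Σ_{i<k} [r]` is iterated integrand additivity
    have h1 : KZ.of z - KZ.of r' - ∑ _i : Fin k, KZ.of r ∈ KZ.relations :=
      KZ.of_sub_of_sub_sum_mem_relations k z r' (fun _ => r) (hd.trans hzd.symm)
        (fun _ => hzd.symm) fun x hx => by
          have hx' : x ∈ r.domain := hzd ▸ hx
          simp only [h hx', hzi, Pi.zero_apply, Finset.sum_const, Finset.card_univ,
            Fintype.card_fin, nsmul_eq_mul, Int.cast_neg, Int.cast_natCast, neg_mul,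
            neg_add_cancel]
    rw [Finset.sum_const, Finset.card_univ, Fintype.card_fin] at h1
    have : KZ.of r' - (-(k : ℤ)) • KZ.of r = KZ.of z - (KZ.of z - KZ.of r' - k • KZ.of r) := by
      rw [neg_zsmul, natCast_zsmul]; abel
    rw [this]
    exact KZ.relations.sub_mem hz h1

end Summit.KontsevichZagierPeriods.InverseLandau

end
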